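import Literature.Geometry.Lorentzian.KerrSchildWaveCauchyProblem
import Summits.FinalStateConjecture.FinalStateConjecture.Theorems.ClusterCompletenessAdiabaticMultiKerrILEDHardyCurrent
import Summits.FinalStateConjecture.FinalStateConjecture.Theorems.ClusterCompletenessAdiabaticMultiKerrILEDRadialMultiplierBulk

/-!
# Crux `AdiabaticMultiKerrILED` (line `Sketch`) — the wave operator of the static tails-cut
# Schwarzschild zone on radial functions

Helper file for the crux `stmt-FinalStateConjecture-14310`
(`Summit.FinalStateConjecture.FinalStateConjecture.Theses.ClusterCompleteness.AdiabaticMultiKerrILED`),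
line `Sketch`, stub `waveOperator_radial_tailsCut` (lead c7, wave 4: the bricks of the
degenerate Morawetz estimate on the zero-spin tails-cut zone, whose zeroth-order bulk term is
`−¼ □_{G₀} ϖ` for a radial Lagrangian weight `ϖ(r)`).

In its rest frame the zero-spin zone is the generalised Kerr–Schild coefficient field
`G₀ = η⁻¹ − μ ℓ♯ ⊗ ℓ♯ = KerrSchild.inverseMetric (χ(r) · 2H) (Kerr.nullVector 0)`, `H = M/r`,
`ℓ♯ = (−1, x⃗/r)`, `χ(r) = Real.smoothTransition (2 − r/(8M))`, i.e. the static metric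
`g = −f dT² + f⁻¹ dr² + r² dΩ²`, `f = 1 − μ`, `μ(r) = χ(r) · 2M/r`, in ingoing coordinates
(`G₀^{00} = −1 − μ`, `G₀^{0i} = μ x_i/r`, `G₀^{ij} = δ_{ij} − μ x_i x_j / r²`). This file proves

* `waveOperator_radial_tailsCut` — **the radial formula**
  `□_{G₀} (u ∘ r)(x) = r⁻² (d/ds) [s² f(s) u′(s)] (r(x))` for `u ∈ C²` at `r(x) > 0`
  (`□_{G₀} = ∑_μ ∂_μ G₀^{μν} ∂_ν = KerrSchild.waveOperator G₀`, the radial part of `□_g`).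

Proof: `∂₀(u∘r) = 0`, `∂_j(u∘r) = u′ x_j/r` (`radialBulk_fderiv_radius_zero`), so the fluxes
(`radialWave_flux`, from `ℓ♯ = (−1, x⃗/r)`, `H = M/r` and `|x⃗/r| = 1`) are
`∑_ν G₀^{0ν} ∂_ν(u∘r) = μ u′`, a function of `r` alone whose `∂₀` vanishes
(`hardy_fderiv_comp_radius_basisVector_zero`), and `∑_ν G₀^{iν} ∂_ν(u∘r) = h(r) x_i` with
`h = f u′/r`, whose Euclidean divergence is `r h′ + 3h` (`hardy_sum_fderiv_comp_radius_mul_coord`)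
`= r⁻² (s³ h)′(r) = r⁻² (s² f u′)′(r)`. The radius calculus at `a = 0` is imported from the
neighbouring crux modules `…HardyCurrent` and `…RadialMultiplierBulk`.

Dafermos–Rodnianski arXiv:0811.0354, §4.1.1 (the Morawetz current with a radial weight on
Schwarzschild; `□_g` on radial functions). [folklore]
-/

noncomputable section

-- the doubled `FinalStateConjecture.FinalStateConjecture` path component trips dupNamespace
set_option linter.dupNamespace false

open scoped ContDiff Topology BigOperators
open Filter Literature.Geometry.Lorentzian

namespace Summit.FinalStateConjecture.FinalStateConjecture.Theorems

/-! ### Zero-spin component formulas -/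

/-- For `a = 0`, `ℓ♯ = (−1, x⃗ / r)` componentwise on all of `E4` (`Kerr.nullVector_apply_zero`,
`radialBulk_nullVector_succ`; on the axis the spatial components of both sides are the junk value
`0`). Visser arXiv:0706.0622, (34). [folklore] -/
theorem radialWave_nullVector_zero_apply (y : E4) (μ : Fin 4) :
    Kerr.nullVector 0 y μ = if μ = 0 then -1 else y μ / Kerr.radius 0 y := by
  refine Fin.cases ?_ (fun i ↦ ?_) μ
  · simp
  · rw [if_neg (Fin.succ_ne_zero i), radialBulk_nullVector_succ]

/-- Off the axis the spatial direction cosines form a unit vector: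
`(x₁/r)² + (x₂/r)² + (x₃/r)² = 1`, `r = Kerr.radius 0 x = ‖x⃗‖`. [folklore] -/
theorem radialWave_sum_sq_div_radius {y : E4} (hy : 0 < Kerr.radius 0 y) :
    (y 1 / Kerr.radius 0 y) ^ 2 + (y 2 / Kerr.radius 0 y) ^ 2 + (y 3 / Kerr.radius 0 y) ^ 2 = 1 := by
  have hr : Kerr.radius 0 y ≠ 0 := hy.ne'
  have hsq : Kerr.radius 0 y ^ 2 = y 1 ^ 2 + y 2 ^ 2 + y 3 ^ 2 := by
    rw [Kerr.radius_zero_left, E4.spatialNorm_sq]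
  field_simp
  linarith

/-! ### The fluxes of a radial gradient through the tails-cut field -/

/-- **The fluxes of a radial gradient through the zero-spin tails-cut field.** With
`p_ν = U ∂_ν r` (`∂₀ r = 0`, `∂_j r = x_j/r`) and `G₀ = η⁻¹ − μ ℓ♯ ⊗ ℓ♯`, `μ = χ · 2M/r`,
`ℓ♯ = (−1, x⃗/r)`: `∑_ν G₀^{0ν} p_ν = μ U` and `∑_ν G₀^{iν} p_ν = (1 − μ) U x_i / r`
(`|x⃗/r| = 1`). [folklore] -/
theorem radialWave_flux (M U : ℝ) {y : E4} (hy : 0 < Kerr.radius 0 y) (μ : Fin 4) :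
    ∑ ν, KerrSchild.inverseMetric
        (fun z ↦ Real.smoothTransition (2 - Kerr.radius 0 z / (8 * M)) * (2 * Kerr.scalarH M 0 z))
        (Kerr.nullVector 0) y μ ν * (U * if ν = 0 then 0 else (Kerr.radius 0 y)⁻¹ * y ν) =
      if μ = 0 then
        Real.smoothTransition (2 - Kerr.radius 0 y / (8 * M)) * (2 * M / Kerr.radius 0 y) * U
      else
        (1 - Real.smoothTransition (2 - Kerr.radius 0 y / (8 * M)) * (2 * M / Kerr.radius 0 y)) *
          U / Kerr.radius 0 y * y μ := by
  have ht := radialWave_sum_sq_div_radius hy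
  simp only [KerrSchild.inverseMetric, radialWave_nullVector_zero_apply, hardy_scalarH_zero M,
    Kerr.etaComp, Fin.sum_univ_four, Fin.isValue]
  set ρ : ℝ := Kerr.radius 0 y
  set χ₀ : ℝ := Real.smoothTransition (2 - ρ / (8 * M))
  have h10 : (1 : Fin 4) ≠ 0 := by decide
  have h20 : (2 : Fin 4) ≠ 0 := by decide
  have h30 : (3 : Fin 4) ≠ 0 := by decide
  have h01 : (0 : Fin 4) ≠ 1 := by decide
  have h02 : (0 : Fin 4) ≠ 2 := by decide
  have h03 : (0 : Fin 4) ≠ 3 := by decide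
  have h12 : (1 : Fin 4) ≠ 2 := by decide
  have h13 : (1 : Fin 4) ≠ 3 := by decide
  have h21 : (2 : Fin 4) ≠ 1 := by decide
  have h23 : (2 : Fin 4) ≠ 3 := by decide
  have h31 : (3 : Fin 4) ≠ 1 := by decide
  have h32 : (3 : Fin 4) ≠ 2 := by decide
  fin_cases μ <;>
    simp only [Fin.isValue, Fin.reduceFinMk, Fin.zero_eta, Fin.mk_one, h10, h20, h30, h01, h02,
      h03, h12, h13, h21, h23, h31, h32, if_true, if_false]
  · linear_combination χ₀ * (2 * M / ρ) * U * ht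
  · linear_combination -(χ₀ * (2 * M / ρ) * U * (y 1 / ρ)) * ht
  · linear_combination -(χ₀ * (2 * M / ρ) * U * (y 2 / ρ)) * ht
  · linear_combination -(χ₀ * (2 * M / ρ) * U * (y 3 / ρ)) * ht

/-! ### The radial formula -/

/-- **The wave operator of the static tails-cut Schwarzschild field on radial functions**: for
`u = u(r)` of class `C²` at `r(x) > 0`,
`□_{G₀} (u ∘ r)(x) = r⁻² (d/ds)[s² f(s) u′(s)]_{s = r(x)}` with `f(s) = 1 − χ(2 − s/(8M)) · 2M/s`
(`□_{G₀} = ∑_μ ∂_μ G₀^{μν} ∂_ν = KerrSchild.waveOperator G₀`; this is the radial part of `□_g` for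
`g = −f dT² + f⁻¹ dr² + r² dΩ²` in ingoing coordinates: the fluxes are `A⁰ = μ u′(r)` with
`∂₀ A⁰ = 0` and `A^i = h(r) x_i`, `h = f u′/r`, with `∑_i ∂_i A^i = r h′ + 3 h = r⁻² (s³ h)′(r)`).
Dafermos–Rodnianski arXiv:0811.0354, §4.1.1. [folklore] -/
theorem waveOperator_radial_tailsCut : ∀ (M : ℝ) (u : ℝ → ℝ) (x : E4), 0 < M → 0 < Kerr.radius 0 x → ContDiffAt ℝ 2 u (Kerr.radius 0 x) → KerrSchild.waveOperator (KerrSchild.inverseMetric (fun y ↦ Real.smoothTransition (2 - Kerr.radius 0 y / (8 * M)) * (2 * Kerr.scalarH M 0 y)) (Kerr.nullVector 0)) (fun y ↦ u (Kerr.radius 0 y)) x = (Kerr.radius 0 x)⁻¹ ^ 2 * deriv (fun s ↦ s ^ 2 * (fun s : ℝ ↦ 1 - Real.smoothTransition (2 - s / (8 * M)) * (2 * M / s)) s * deriv u s) (Kerr.radius 0 x) := by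
  intro M u x _hM hx hu
  have hx0 : Kerr.radius 0 x ≠ 0 := hx.ne'
  -- `u` is differentiable near `r(x)`, and `u'` is differentiable at `r(x)`
  have hu1 : ∀ᶠ t in 𝓝 (Kerr.radius 0 x), DifferentiableAt ℝ u t := by
    filter_upwards [hu.eventually (by simp)] with t ht using ht.differentiableAt (by simp)
  have hu2 : DifferentiableAt ℝ (deriv u) (Kerr.radius 0 x) := by
    have h1 : DifferentiableAt ℝ (fderiv ℝ u) (Kerr.radius 0 x) :=
      (hu.fderiv_right (m := 1) le_rfl).differentiableAt (by simp)
    have h2 : deriv u = fun t ↦ fderiv ℝ u t 1 := funext fun t ↦ rfl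
    rw [h2]
    exact h1.clm_apply (differentiableAt_const _)
  -- the 1-D profile `φ₁ = χ · 2M/s`, the time flux `q = φ₁ u'` and `h = (1 − φ₁) u' / s`
  obtain ⟨φ₁, hφ₁⟩ : ∃ φ₁ : ℝ → ℝ,
      φ₁ = fun s ↦ Real.smoothTransition (2 - s / (8 * M)) * (2 * M / s) := ⟨_, rfl⟩
  have hφd : DifferentiableAt ℝ φ₁ (Kerr.radius 0 x) := by
    rw [hφ₁]
    have h1 : DifferentiableAt ℝ (fun s : ℝ ↦ 2 - s / (8 * M)) (Kerr.radius 0 x) :=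
      (differentiableAt_fun_id.div_const (8 * M)).const_sub 2
    have h2 : DifferentiableAt ℝ (fun s : ℝ ↦ Real.smoothTransition (2 - s / (8 * M)))
        (Kerr.radius 0 x) :=
      ((Real.smoothTransition.contDiffAt (n := 1)).differentiableAt (by simp)).comp _ h1
    have h3 : DifferentiableAt ℝ (fun s : ℝ ↦ 2 * M / s) (Kerr.radius 0 x) :=
      (differentiableAt_const (2 * M)).fun_div differentiableAt_fun_id hx0
    exact h2.fun_mul h3
  obtain ⟨q, hq⟩ : ∃ q : ℝ → ℝ, q = fun s ↦ φ₁ s * deriv u s := ⟨_, rfl⟩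
  obtain ⟨h, hh⟩ : ∃ h : ℝ → ℝ, h = fun s ↦ (1 - φ₁ s) * deriv u s / s := ⟨_, rfl⟩
  have hqd : DifferentiableAt ℝ q (Kerr.radius 0 x) := by
    rw [hq]
    exact hφd.fun_mul hu2
  have hhd : DifferentiableAt ℝ h (Kerr.radius 0 x) := by
    rw [hh]
    exact (((differentiableAt_const 1).fun_sub hφd).fun_mul hu2).fun_div
      differentiableAt_fun_id hx0
  -- near `x`: `r > 0` and `u` is differentiable at `r(y)`
  have hpos : ∀ᶠ y in 𝓝 x, 0 < Kerr.radius 0 y :=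
    (isOpen_lt continuous_const (Kerr.continuous_radius 0)).mem_nhds hx
  have hnear : ∀ᶠ y in 𝓝 x, 0 < Kerr.radius 0 y ∧ DifferentiableAt ℝ u (Kerr.radius 0 y) :=
    hpos.and ((Kerr.continuous_radius 0).continuousAt.eventually hu1)
  -- Step 1: the fluxes `A^μ = ∑_ν G₀^{μν} ∂_ν (u ∘ r)` near `x`: `A⁰ = q(r)`, `A^i = h(r) x_i`
  set G : E4 → Fin 4 → Fin 4 → ℝ := KerrSchild.inverseMetric
      (fun y ↦ Real.smoothTransition (2 - Kerr.radius 0 y / (8 * M)) * (2 * Kerr.scalarH M 0 y))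
      (Kerr.nullVector 0) with hG
  have hflux : ∀ᶠ y in 𝓝 x, ∀ μ : Fin 4,
      ∑ ν, G y μ ν * fderiv ℝ (fun z ↦ u (Kerr.radius 0 z)) y (E4.basisVector ν) =
        if μ = 0 then q (Kerr.radius 0 y) else h (Kerr.radius 0 y) * y μ := by
    filter_upwards [hnear] with y hy μ
    obtain ⟨hy0, hyu⟩ := hy
    have hc : HasFDerivAt (fun z ↦ u (Kerr.radius 0 z))
        (deriv u (Kerr.radius 0 y) • fderiv ℝ (Kerr.radius 0) y) y :=
      hyu.hasDerivAt.comp_hasFDerivAt y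
        (hardy_hasFDerivAt_radius_zero rfl hy0).differentiableAt.hasFDerivAt
    have hp : ∀ ν, fderiv ℝ (fun z ↦ u (Kerr.radius 0 z)) y (E4.basisVector ν) =
        deriv u (Kerr.radius 0 y) * (if ν = 0 then 0 else (Kerr.radius 0 y)⁻¹ * y ν) :=
      fun ν ↦ by rw [hc.fderiv, smul_apply, smul_eq_mul, radialBulk_fderiv_radius_zero hy0]
    simp only [hp]
    rw [hG, radialWave_flux M (deriv u (Kerr.radius 0 y)) hy0 μ]
    simp only [hq, hh, hφ₁]
  -- Step 2: `∂₀ A⁰ = ∂₀ (q ∘ r) = 0`, and `∂_i A^i = ∂_i (h(r) x_i)` at `x`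
  have hA0 : fderiv ℝ (fun y ↦ ∑ ν, G y 0 ν * fderiv ℝ (fun z ↦ u (Kerr.radius 0 z)) y
      (E4.basisVector ν)) x (E4.basisVector 0) = 0 := by
    have hev : (fun y ↦ ∑ ν, G y 0 ν * fderiv ℝ (fun z ↦ u (Kerr.radius 0 z)) y
        (E4.basisVector ν)) =ᶠ[𝓝 x] fun y ↦ q (Kerr.radius 0 y) := by
      filter_upwards [hflux] with y hy
      rw [hy 0, if_pos rfl]
    rw [hev.fderiv_eq]
    exact hardy_fderiv_comp_radius_basisVector_zero rfl hx hqd.hasDerivAt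
  have hAi : ∀ i : Fin 3, fderiv ℝ (fun y ↦ ∑ ν, G y i.succ ν *
      fderiv ℝ (fun z ↦ u (Kerr.radius 0 z)) y (E4.basisVector ν)) x (E4.basisVector i.succ) =
        fderiv ℝ (fun y ↦ h (Kerr.radius 0 y) * y i.succ) x (E4.basisVector i.succ) := by
    intro i
    have hev : (fun y ↦ ∑ ν, G y i.succ ν * fderiv ℝ (fun z ↦ u (Kerr.radius 0 z)) y
        (E4.basisVector ν)) =ᶠ[𝓝 x] fun y ↦ h (Kerr.radius 0 y) * y i.succ := by
      filter_upwards [hflux] with y hy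
      rw [hy i.succ, if_neg (Fin.succ_ne_zero i)]
    rw [hev.fderiv_eq]
  -- Step 3: `□ (u ∘ r) = ∑_i ∂_i (h(r) x_i) = r h' + 3 h = r⁻² (s³ h)'(r) = r⁻² (s² f u')'(r)`
  rw [KerrSchild.waveOperator_apply, Fin.sum_univ_succ, hA0, zero_add,
    Finset.sum_congr rfl fun i _ ↦ hAi i,
    hardy_sum_fderiv_comp_radius_mul_coord rfl hx hhd.hasDerivAt]
  have hev : (fun s ↦ s ^ 2 * (fun s : ℝ ↦ 1 - Real.smoothTransition (2 - s / (8 * M)) *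
      (2 * M / s)) s * deriv u s) =ᶠ[𝓝 (Kerr.radius 0 x)] fun s ↦ s ^ 3 * h s := by
    filter_upwards [Ioi_mem_nhds hx] with s hs
    have hs0 : s ≠ 0 := (Set.mem_Ioi.mp hs).ne'
    rw [hh, hφ₁]
    beta_reduce
    field_simp
  have hpow : HasDerivAt (fun s ↦ s ^ 3 * h s)
      (3 * Kerr.radius 0 x ^ 2 * h (Kerr.radius 0 x) +
        Kerr.radius 0 x ^ 3 * deriv h (Kerr.radius 0 x)) (Kerr.radius 0 x) := by
    refine ((hasDerivAt_pow 3 (Kerr.radius 0 x)).fun_mul hhd.hasDerivAt).congr_deriv ?_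
    norm_num
  rw [hev.deriv_eq, hpow.deriv]
  field_simp
  ring

end Summit.FinalStateConjecture.FinalStateConjecture.Theorems

end
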